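import Literature.NumberTheory.Automorphic.HeckeFixedVectorsLift
import HarnessLib

/-!
# The `K`-fixed part of a `G`-span is its Hecke span; intertwiners on `K`-fixed vectors (Bushnell–Henniart §4.2–4.3)

Topic `NumberTheory/Automorphic`; namespace `Literature.NumberTheory.Automorphic`.  Generic sequel to
`HeckeFixedVectorsSimple` / `HeckeFixedVectorsLift` (Bump, Prop. 4.2.3: `V^K` is a simple module over the Hecke operators
`[KgK]` of `HeckeAlgebra`; Hecke-equivariant maps between the `K`-fixed vectors of two IRREDUCIBLES lift to isomorphisms).
THEOREMS ONLY: no definition, no named fact, no instance, no `sorry`; no topology, no Haar measure — the averaging projector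
`ε_K` is replaced by finite coset sums over finite-index subgroups of `K` (`finsum_apply_out_*` of `HeckeFixedVectorsSimple`).

## Source, as printed

Bushnell–Henniart, *The local Langlands conjecture for GL(2)* (2006), §4.2 Lemma (for `v ∈ V^K`: «`(ℋ(G) ⋆ v)^K = ℋ(G,K) ⋆ v`»,
with `e_K ⋆ ℋ(G) ⋆ e_K = ℋ(G,K)`), §4.3 Proposition («`V ↦ V^K` induces a bijection …») and Corollary 1; Bump, *Automorphic Forms
and Representations* (1997), Prop. 4.2.3 (p. 427) and its proof (`v = ε_K v = ∑ π(ε_K * φᵢ * ε_K) wᵢ`); Cartier, Corvallis 1979,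
§IV.1 (1.5)–(1.6).

## What is formalised (theorems only)

`k` a field of characteristic zero, `K ≤ G` a subgroup all of whose double cosets are finite unions of left cosets
(`hfin : ∀ g, (orbit K (gK)).Finite`, e.g. `K` compact open — `finite_orbit_quotient`), `ρ` a representation of `G` on `V`.

* §1 **the `K`-part of a `G`-span** — for ANY subspace `N ≤ V^K` (not necessarily Hecke-stable; this generality is what a
  change of level `K′ ≤ K` needs): `exists_finiteIndex_finsum_mem_span_heckeOperator` (every `u ∈ k[G]·N` is fixed by a
  finite-index `B ≤ K` and all its coset sums are Hecke combinations of `N`), **`span_translates_inf_fixedPoints`**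
  `(k[G]·N) ∩ V^K = span_k {[KgK] n : g, n ∈ N}` (B–H §4.2 Lemma), `span_translates_inf_fixedPoints_of_stable` (`= N` for a
  Hecke-stable `N`; the membership form is `HeckeFixedVectorsLift.mem_of_mem_span_translates_of_mem_fixedPoints`),
  `span_translates_fixedPoints_eq_top` (an irreducible with `V^K ≠ 0` is the span of the translates of `V^K`).
* §2 **intertwiners on `K`-fixed vectors** — `intertwiningMap_apply_mem_fixedPoints`, `intertwiningMap_apply_heckeOperator`
  (`f [KgK] = [KgK] f`), **`intertwiningMap_eq_of_eqOn_fixedPoints`** (INJECTIVITY of `Hom_G(W,V) → Hom_{ℋ(G,K)}(W^K, V^K)` for `W`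
  irreducible with `W^K ≠ 0`, B–H §4.3), `map_fixedPoints_eq_range_inf` (`f(W^K) = f(W) ∩ V^K` for `W` irreducible).

The SURJECTIVITY half for a semisimple target (every Hecke-equivariant `W^K → V^K` extends to an intertwiner) is the sequel
`HeckeFixedVectorsIntertwiners`.  Cell note (hodgecm-mathlib, crux `HLiu418` = stmt-HodgeConjecture-24832, d6 S2′ binder
`hIsoSpan`): count-neutral generic capital; HC_CM is proved only modulo the 7 printed citations until rung 0 closes.

## References
* [BushnellHenniart2006] C. J. Bushnell, G. Henniart, *The Local Langlands Conjecture for GL(2)*, Grundlehren 335 (2006), §4.2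
  Lemma, §4.3 Proposition and Corollary 1.
* [Bump1997] D. Bump, *Automorphic Forms and Representations*, Cambridge Stud. Adv. Math. 55 (1997), Prop. 4.2.3 (p. 427).
* [CartierCorvallis1979] P. Cartier, *Representations of 𝔭-adic groups: a survey*, Proc. Sympos. Pure Math. 33 (1979), §IV.1.
-/

noncomputable section

open MulAction

namespace Literature.NumberTheory.Automorphic

/-! ## §1 The `K`-fixed part of the `G`-span of `N ≤ V^K` is the Hecke span of `N` -/

section Span

variable {k G V : Type*} [Field k] [CharZero k] [Group G] [AddCommGroup V] [Module k V]
  (ρ : Representation k G V) (K : Subgroup G)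

omit [CharZero k] in
/-- `N` lies in the span of its `G`-translates. [cite: Bump1997, Prop. 4.2.3] -/
theorem le_span_translates (N : Submodule k V) :
    N ≤ Submodule.span k (⋃ h : G, ρ h '' (N : Set V)) := fun n hn =>
  Submodule.subset_span (Set.mem_iUnion.2 ⟨1, n, hn, by rw [map_one, Module.End.one_apply]⟩)

omit [CharZero k] in
/-- **Coset sums of vectors in the `G`-span of `N ≤ V^K` are Hecke combinations** (Bushnell–Henniart §4.2 Lemma,
measure-free form): every `u ∈ k[G]·N` is fixed by a finite-index `B ≤ K`, and for every finite-index `A ≤ B` the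
coset sum `∑_{c ∈ K/A} ρ(c) u` lies in `span_k {[KgK] n : g ∈ G, n ∈ N}`. [cite: BushnellHenniart2006, §4.2 Lemma] -/
theorem exists_finiteIndex_finsum_mem_span_heckeOperator (hfin : ∀ g : G, (orbit K (g : G ⧸ K)).Finite)
    {N : Submodule k V} (hNK : N ≤ ρ.fixedPoints K) {u : V}
    (hu : u ∈ Submodule.span k (⋃ g : G, ρ g '' (N : Set V))) :
    ∃ B : Subgroup K, B.FiniteIndex ∧ u ∈ Representation.fixedPoints (ρ.comp K.subtype) B ∧
      ∀ A : Subgroup K, A ≤ B → A.FiniteIndex →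
        ∑ᶠ c : K ⧸ A, (ρ.comp K.subtype) c.out u ∈ Submodule.span k (⋃ g : G, heckeOperator ρ K g '' (N : Set V)) := by
  classical
  -- the Hecke span
  obtain ⟨HN, hHN⟩ : ∃ HN : Submodule k V, HN = Submodule.span k (⋃ g : G, heckeOperator ρ K g '' (N : Set V)) := ⟨_, rfl⟩
  rw [← hHN]
  have key : ∀ u ∈ Submodule.span k (⋃ g : G, ρ g '' (N : Set V)), ∃ B : Subgroup K, B.FiniteIndex ∧
      u ∈ Representation.fixedPoints (ρ.comp K.subtype) B ∧ ∀ A : Subgroup K, A ≤ B → A.FiniteIndex →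
        ∑ᶠ c : K ⧸ A, (ρ.comp K.subtype) c.out u ∈ HN := by
    intro u hu
    induction hu using Submodule.span_induction with
    | mem x hx =>
      obtain ⟨g, hxg⟩ := Set.mem_iUnion.1 hx
      obtain ⟨w, hw, rfl⟩ := hxg
      refine ⟨stabilizer K (g : G ⧸ K), finiteIndex_stabilizer K g (hfin g),
        apply_mem_fixedPoints_stabilizer ρ K g (hNK hw), fun A hA _ => ?_⟩
      rw [finsum_apply_out_eq_relIndex_smul (ρ.comp K.subtype) hA (apply_mem_fixedPoints_stabilizer ρ K g (hNK hw)),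
        finsum_stabilizer_apply_eq_heckeOperator ρ K g (hfin g) (hNK hw)]
      have hmem : heckeOperator ρ K g w ∈ HN := by
        rw [hHN]
        exact Submodule.subset_span (Set.mem_iUnion.2 ⟨g, w, hw, rfl⟩)
      exact nsmul_mem hmem _
    | zero =>
      refine ⟨⊤, inferInstance, Submodule.zero_mem _, fun A _ _ => ?_⟩
      simp only [map_zero, finsum_zero]
      exact HN.zero_mem
    | add x y _ _ ihx ihy =>
      obtain ⟨B₁, hB₁, hx₁, h₁⟩ := ihx
      obtain ⟨B₂, hB₂, hy₂, h₂⟩ := ihy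
      refine ⟨B₁ ⊓ B₂, ⟨Subgroup.index_inf_ne_zero hB₁.index_ne_zero hB₂.index_ne_zero⟩,
        Submodule.add_mem _ (Representation.fixedPoints_antitone (ρ.comp K.subtype) inf_le_left hx₁)
          (Representation.fixedPoints_antitone (ρ.comp K.subtype) inf_le_right hy₂), fun A hA hAfi => ?_⟩
      letI : Fintype (K ⧸ A) := Fintype.ofFinite _
      simp only [map_add, finsum_eq_sum_of_fintype, Finset.sum_add_distrib]
      have hx' := h₁ A (hA.trans inf_le_left) hAfi
      have hy' := h₂ A (hA.trans inf_le_right) hAfi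
      rw [finsum_eq_sum_of_fintype] at hx' hy'
      exact HN.add_mem hx' hy'
    | smul a x _ ih =>
      obtain ⟨B, hB, hxB, h⟩ := ih
      refine ⟨B, hB, Submodule.smul_mem _ a hxB, fun A hA hAfi => ?_⟩
      letI : Fintype (K ⧸ A) := Fintype.ofFinite _
      simp only [map_smul, finsum_eq_sum_of_fintype, ← Finset.smul_sum]
      have hx' := h A hA hAfi
      rw [finsum_eq_sum_of_fintype] at hx'
      exact HN.smul_mem a hx'
  exact key u hu

/-- **`(k[G]·N) ∩ V^K = span_k {[KgK] n}`** for `N ≤ V^K` (Bushnell–Henniart §4.2 Lemma «`(ℋ(G) v)^K = ℋ(G,K) v`»;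
Cartier §IV.1): a `K`-fixed vector of the `G`-span is `[K:B]⁻¹` times its coset sum, a Hecke combination; conversely
`[KgK] n = ∑_{yK ⊆ KgK} ρ(y) n` is a `K`-fixed vector of the span. [cite: BushnellHenniart2006, §4.2 Lemma]
[cite: Bump1997, Prop. 4.2.3] -/
theorem span_translates_inf_fixedPoints (hfin : ∀ g : G, (orbit K (g : G ⧸ K)).Finite)
    {N : Submodule k V} (hNK : N ≤ ρ.fixedPoints K) :
    Submodule.span k (⋃ g : G, ρ g '' (N : Set V)) ⊓ ρ.fixedPoints K =
      Submodule.span k (⋃ g : G, heckeOperator ρ K g '' (N : Set V)) := by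
  classical
  refine le_antisymm ?_ ?_
  · rintro v ⟨hv, hvK⟩
    obtain ⟨B, hBfi, -, hB⟩ := exists_finiteIndex_finsum_mem_span_heckeOperator ρ K hfin hNK hv
    have hvinv : v ∈ Representation.invariants (ρ.comp K.subtype) := hvK
    have hmem := hB B le_rfl hBfi
    rw [finsum_apply_out_eq_index_smul (ρ.comp K.subtype) B hvinv, ← Nat.cast_smul_eq_nsmul k] at hmem
    have hidx : (B.index : k) ≠ 0 := Nat.cast_ne_zero.2 hBfi.index_ne_zero
    rw [show v = (B.index : k)⁻¹ • ((B.index : k) • v) by rw [smul_smul, inv_mul_cancel₀ hidx, one_smul]]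
    exact Submodule.smul_mem _ _ hmem
  · refine Submodule.span_le.2 fun x hx => ?_
    obtain ⟨g, hxg⟩ := Set.mem_iUnion.1 hx
    obtain ⟨n, hn, rfl⟩ := hxg
    refine ⟨?_, heckeOperator_apply_mem_fixedPoints ρ K g (hNK hn) (hfin g)⟩
    change heckeOperator ρ K g n ∈ Submodule.span k (⋃ g : G, ρ g '' (N : Set V))
    rw [heckeOperator_apply_eq_sum_out ρ K g (hfin g) (hNK hn)]
    exact Submodule.sum_mem _ fun α _ => Submodule.subset_span (Set.mem_iUnion.2 ⟨α.out, n, hn, rfl⟩)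

/-- **`(k[G]·N) ∩ V^K = N` for a Hecke-stable `N ≤ V^K`.** [cite: BushnellHenniart2006, §4.2 Lemma] [cite: Bump1997, Prop. 4.2.3] -/
theorem span_translates_inf_fixedPoints_of_stable (hfin : ∀ g : G, (orbit K (g : G ⧸ K)).Finite)
    {N : Submodule k V} (hNK : N ≤ ρ.fixedPoints K) (hstab : ∀ g : G, ∀ n ∈ N, heckeOperator ρ K g n ∈ N) :
    Submodule.span k (⋃ g : G, ρ g '' (N : Set V)) ⊓ ρ.fixedPoints K = N := by
  rw [span_translates_inf_fixedPoints ρ K hfin hNK]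
  refine le_antisymm (Submodule.span_le.2 fun x hx => ?_) fun n hn => ?_
  · obtain ⟨g, hxg⟩ := Set.mem_iUnion.1 hx
    obtain ⟨n, hn, rfl⟩ := hxg
    exact hstab g n hn
  · exact Submodule.subset_span (Set.mem_iUnion.2 ⟨1, n, hn, heckeOperator_one_apply ρ K (hNK hn)⟩)

omit [CharZero k] in
/-- **An irreducible representation with a `K`-fixed vector is the span of the `G`-translates of `V^K`.**
[cite: Bump1997, Prop. 4.2.3] -/
theorem span_translates_fixedPoints_eq_top [ρ.IsIrreducible] (hne : ρ.fixedPoints K ≠ ⊥) :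
    Submodule.span k (⋃ g : G, ρ g '' (ρ.fixedPoints K : Set V)) = ⊤ := by
  obtain ⟨U, hU⟩ : ∃ U : Subrepresentation ρ, U.toSubmodule = Submodule.span k (⋃ g : G, ρ g '' (ρ.fixedPoints K : Set V)) :=
    ⟨⟨_, fun g x hx => map_span_translates_le ρ _ g (Submodule.mem_map_of_mem hx)⟩, rfl⟩
  have hUbot : U ≠ ⊥ := by
    intro h
    apply hne
    rw [eq_bot_iff]
    intro v hv
    have hv' : v ∈ U.toSubmodule := hU ▸ le_span_translates ρ _ hv
    rw [h] at hv'
    exact hv'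
  have hUtop : U = ⊤ := (IsSimpleOrder.eq_bot_or_eq_top U).resolve_left hUbot
  rw [← hU, hUtop]
  rfl

end Span

/-! ## §2 Intertwiners and `K`-fixed vectors: Hecke-equivariance, uniqueness, images -/

section Unique

variable {k G V W : Type*} [Field k] [CharZero k] [Group G] [AddCommGroup V] [Module k V] [AddCommGroup W] [Module k W]
  (ρ : Representation k G W) (σ : Representation k G V) (K : Subgroup G)

omit [CharZero k] in
/-- Intertwiners map `W^K` into `V^K`. [cite: Bump1997, Prop. 4.2.3] -/
theorem intertwiningMap_apply_mem_fixedPoints (f : ρ.IntertwiningMap σ) {w : W} (hw : w ∈ ρ.fixedPoints K) :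
    f w ∈ σ.fixedPoints K := by
  rw [Representation.mem_fixedPoints] at hw ⊢
  intro g hg
  rw [← Representation.IntertwiningMap.isIntertwining ρ σ f g w, hw g hg]

omit [CharZero k] in
/-- **Hecke operators commute with intertwiners**: `f ([KgK] w) = [KgK] (f w)` for a finite double coset (both are
`∑ᵢ` over the same representatives). [cite: Bump1997, Prop. 4.2.3] -/
theorem intertwiningMap_apply_heckeOperator (f : ρ.IntertwiningMap σ) (g : G) (hfin : (orbit K (g : G ⧸ K)).Finite)
    (w : W) : f (heckeOperator ρ K g w) = heckeOperator σ K g (f w) := by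
  classical
  rw [heckeOperator, heckeOperator, finsum_mem_eq_finite_toFinset_sum _ hfin, finsum_mem_eq_finite_toFinset_sum _ hfin,
    LinearMap.sum_apply, LinearMap.sum_apply, map_sum]
  exact Finset.sum_congr rfl fun y _ => Representation.IntertwiningMap.isIntertwining ρ σ f _ _

omit [CharZero k] in
/-- **UNIQUENESS** (injectivity of `Hom_G(W, V) → Hom_{ℋ(G,K)}(W^K, V^K)`): two intertwiners out of an irreducible `W`
with `W^K ≠ 0` which agree on `W^K` are equal — `W` is the span of the `G`-translates of `W^K`.
[cite: Bump1997, Prop. 4.2.3] [cite: BushnellHenniart2006, §4.3 Proposition] -/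
theorem intertwiningMap_eq_of_eqOn_fixedPoints [ρ.IsIrreducible] (hne : ρ.fixedPoints K ≠ ⊥)
    (f f' : ρ.IntertwiningMap σ) (h : ∀ w ∈ ρ.fixedPoints K, f w = f' w) : f = f' := by
  apply Representation.IntertwiningMap.ext
  apply LinearMap.ext
  intro w
  have hw : w ∈ Submodule.span k (⋃ g : G, ρ g '' (ρ.fixedPoints K : Set W)) := by
    rw [span_translates_fixedPoints_eq_top ρ K hne]
    exact Submodule.mem_top
  have hle : Submodule.span k (⋃ g : G, ρ g '' (ρ.fixedPoints K : Set W)) ≤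
      LinearMap.ker (f.toLinearMap - f'.toLinearMap) := by
    refine Submodule.span_le.2 fun x hx => ?_
    obtain ⟨g, hxg⟩ := Set.mem_iUnion.1 hx
    obtain ⟨v, hv, rfl⟩ := hxg
    change f (ρ g v) - f' (ρ g v) = 0
    rw [Representation.IntertwiningMap.isIntertwining ρ σ f, Representation.IntertwiningMap.isIntertwining ρ σ f',
      h v hv, sub_self]
  have := hle hw
  rw [LinearMap.mem_ker, LinearMap.sub_apply, sub_eq_zero] at this
  exact this

omit [CharZero k] in
/-- **`f(W^K) = f(W) ∩ V^K`** for an intertwiner out of an irreducible `W` (it is injective or zero).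
[cite: Bump1997, Prop. 4.2.3] -/
theorem map_fixedPoints_eq_range_inf [ρ.IsIrreducible] (f : ρ.IntertwiningMap σ) :
    (ρ.fixedPoints K).map f.toLinearMap = LinearMap.range f.toLinearMap ⊓ σ.fixedPoints K := by
  refine le_antisymm ?_ ?_
  · rintro _ ⟨w, hw, rfl⟩
    exact ⟨⟨w, rfl⟩, intertwiningMap_apply_mem_fixedPoints ρ σ K f hw⟩
  · rintro v ⟨⟨w, rfl⟩, hvK⟩
    rcases Representation.IsIrreducible.injective_or_eq_zero f with hinj | h0
    · refine ⟨w, ?_, rfl⟩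
      have hvK' : f w ∈ σ.fixedPoints K := hvK
      rw [Representation.mem_fixedPoints] at hvK'
      rw [SetLike.mem_coe, Representation.mem_fixedPoints]
      intro g hg
      apply hinj
      rw [Representation.IntertwiningMap.isIntertwining ρ σ f]
      exact hvK' g hg
    · subst h0
      exact ⟨0, Submodule.zero_mem _, by simp⟩

end Unique

end Literature.NumberTheory.Automorphic
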